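import Mathlib
import Summits.ValiantsHypothesis.ValiantsHypothesis.Theses.RigidityForcesSymmetry
import Summits.ValiantsHypothesis.ValiantsHypothesis.Theorems.RigidityForcesSymmetryRankInfRigidToLocallyOpen
import Summits.ValiantsHypothesis.ValiantsHypothesis.Theorems.RigidityForcesSymmetryGrenetFirstOrderRankRigid
import Summits.ValiantsHypothesis.ValiantsHypothesis.Theorems.RigidityForcesSymmetryRankRigidityForcesTorus
import Summits.ValiantsHypothesis.ValiantsHypothesis.Theorems.BorderApolarityToricWitnessObstructionQPStubTorusBound
import Literature.Computability.AlgebraicComplexity.PermanentVsDeterminantProofs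
import Literature.Computability.AlgebraicComplexity.StandardFamiliesProofs

/-!
# Crux `RigidityForcesSymmetry.RankRigidMinimalRepr` (stmt-ValiantsHypothesis-18034) — CALIBRATION, now
# unconditional: the crux is literally the route's target `GrenetLowerBound`

Route `ValiantsHypothesis/RigidityForcesSymmetry`.  The crux-strategist's calibration
(`Cruxes/RankRigidMinimalRepr/CruxCalibration.lean`: `tightRankRigid_of_inf`, `crux_of_target`,
`target_of_crux`, `crux_iff_target`) is stated there modulo two sub-cruxes, A1 `TightRankInfRigid` (= the route's
`GrenetFirstOrderRankRigid`, stmt-21029) and A2 `RankInfRigidToLocallyOpen` (stmt-24282).  Both are now tree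
theorems (`GrenetGauge.GrenetFirstOrderRankRigid_proof`, `RankSlice.RankInfRigidToLocallyOpen_proof`), as is the
support `RankRigidityForcesTorus` (`rankRigidityForcesTorus_proof`) and `TorusBound`
(`BorderApolarityToricWitnessObstructionQP.stub_torusBound`).  This file records the unconditional consequences,
re-proved against the ROUTE decls (Cruxes files are not importable from Theorems):

* `tightRankRigid` — **Sub-crux A (`TightRankRigid`) holds**: for every `n ≥ 3` Grenet's size-`2ⁿ − 1`
  representation of `per_n` has a `GL × GL`-orbit that is open inside its rank stratum of `{det = per_n}` near it.
* `grenetLowerBound_of_rankRigidMinimalRepr`, `rankRigidMinimalRepr_of_grenetLowerBound`,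
  `rankRigidMinimalRepr_iff_grenetLowerBound` — **the crux `RankRigidMinimalRepr` is EQUIVALENT to the target
  `GrenetLowerBound`** ("Grenet's bound `2ⁿ − 1 ≤ dc(per_n)` is attained for infinitely many `n`"), with no
  remaining hypothesis.  So every line on crux 18034 must prove exactly `GrenetLowerBound`; the
  deformation-theoretic phrasing has no residual content.  (Tier: frontier — `dc(per_n)` is open; this does not
  move `ValiantsHypothesis`.)
-/

noncomputable section

set_option autoImplicit false

-- the mandated summit-side namespace repeats a component by design (single-problem summit)
set_option linter.dupNamespace false

namespace Summit.ValiantsHypothesis.ValiantsHypothesis.Theorems.RigidityForcesSymmetry.RankSlice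

open Literature.Computability.AlgebraicComplexity
open Summit.ValiantsHypothesis.ValiantsHypothesis.Theses.RigidityForcesSymmetry

/-- **Sub-crux A `TightRankRigid` (unconditional).**  For every `n ≥ 3` there is a size-`2ⁿ − 1` affine
determinantal representation `(Λ, A)` of `per_n` (Grenet's) whose `GL × GL`-orbit is open inside its rank stratum
of `{det = per_n}` near `(Λ, A)` — from A1 (`GrenetFirstOrderRankRigid_proof`) and A2
(`RankInfRigidToLocallyOpen_proof`), `per_n ≠ 0`. [cite: Grenet2011, Thm. 1] -/
theorem tightRankRigid :
    ∀ n : ℕ, 3 ≤ n → ∃ (Λ : Matrix (Fin (2 ^ n - 1)) (Fin (2 ^ n - 1)) ℂ)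
      (A : Fin n × Fin n → Matrix (Fin (2 ^ n - 1)) (Fin (2 ^ n - 1)) ℂ),
    (Λ.map MvPolynomial.C + ∑ v, (MvPolynomial.X v : MvPolynomial (Fin n × Fin n) ℂ) • (A v).map MvPolynomial.C).det
        = perPoly (Fin n) ℂ ∧
    ∃ U ∈ nhds (Λ, A), ∀ p ∈ U,
      (p.1.map MvPolynomial.C + ∑ v, (MvPolynomial.X v : MvPolynomial (Fin n × Fin n) ℂ) • (p.2 v).map MvPolynomial.C).det
          = perPoly (Fin n) ℂ →
      (∀ v, (p.2 v).rank ≤ (A v).rank) →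
      ∃ g h : GL (Fin (2 ^ n - 1)) ℂ,
        p.1 = (g : Matrix _ _ ℂ) * Λ * ((h⁻¹ : GL (Fin (2 ^ n - 1)) ℂ) : Matrix _ _ ℂ) ∧
        ∀ v, p.2 v = (g : Matrix _ _ ℂ) * A v * ((h⁻¹ : GL (Fin (2 ^ n - 1)) ℂ) : Matrix _ _ ℂ) := by
  intro n hn
  obtain ⟨Λ, A, hdet, hrig⟩ :=
    Summit.ValiantsHypothesis.Theorems.RigidityForcesSymmetry.GrenetGauge.GrenetFirstOrderRankRigid_proof n hn
  exact ⟨Λ, A, hdet, RankInfRigidToLocallyOpen_proof (Fin n × Fin n) (2 ^ n - 1) (perPoly (Fin n) ℂ) Λ A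
    (perPoly_ne_zero (Fin n) ℂ) hdet hrig⟩

/-- **(→) crux ⇒ target, unconditionally**: `RankRigidMinimalRepr → GrenetLowerBound`, through the proved support
`RankRigidityForcesTorus` (`rankRigidityForcesTorus_proof`) and the proved `TorusBound`
(`BorderApolarityToricWitnessObstructionQP.stub_torusBound`). [cite: LandsbergRessayre2017, Thm. 2.8] -/
theorem grenetLowerBound_of_rankRigidMinimalRepr (h : RankRigidMinimalRepr) : GrenetLowerBound := by
  intro n₀
  obtain ⟨n, hn, m, Λ, A, hm, hdet, hU⟩ := h (max n₀ 3)
  have h3 : 3 ≤ n := le_trans (le_max_right n₀ 3) hn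
  refine ⟨n, le_trans (le_max_left n₀ 3) hn, ?_⟩
  have hb := Theorems.BorderApolarityToricWitnessObstructionQP.stub_torusBound n h3 m _
    (Summit.ValiantsHypothesis.ValiantsHypothesis.Theorems.rankRigidityForcesTorus_proof n h3 m Λ A hdet hU)
  rw [hm] at hb
  exact hb

/-- **(←) target ⇒ crux, unconditionally**: if Grenet's bound is attained infinitely often, then at each such
`n ≥ 3` Grenet's rank-rigid representation (`tightRankRigid`) is MINIMAL (Grenet's upper bound
`determinantalComplexity_perPoly_le_holds`), which is the crux. [cite: Grenet2011, Thm. 1] -/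
theorem rankRigidMinimalRepr_of_grenetLowerBound (hG : GrenetLowerBound) : RankRigidMinimalRepr := by
  intro n₀
  obtain ⟨n, hn, hlow⟩ := hG (max n₀ 3)
  have h3 : 3 ≤ n := le_trans (le_max_right n₀ 3) hn
  have hup : determinantalComplexity (perPoly (Fin n) ℂ) ≤ 2 ^ n - 1 :=
    determinantalComplexity_perPoly_le_holds ℂ n (by omega)
  obtain ⟨Λ, A, hdet, hU⟩ := tightRankRigid n h3
  exact ⟨n, le_trans (le_max_left n₀ 3) hn, 2 ^ n - 1, Λ, A, (le_antisymm hup hlow).symm, hdet, hU⟩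

/-- **Calibration (unconditional): the crux `RankRigidMinimalRepr` (stmt-18034) IS the route's target
`GrenetLowerBound`** ("Grenet is exactly optimal infinitely often"). [cite: Grenet2011, Thm. 1]
[cite: LandsbergRessayre2017, Thm. 2.8] -/
theorem rankRigidMinimalRepr_iff_grenetLowerBound : RankRigidMinimalRepr ↔ GrenetLowerBound :=
  ⟨grenetLowerBound_of_rankRigidMinimalRepr, rankRigidMinimalRepr_of_grenetLowerBound⟩

end Summit.ValiantsHypothesis.ValiantsHypothesis.Theorems.RigidityForcesSymmetry.RankSlice

end
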